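import Literature.NumberTheory.Sieve.GrahamWeightsDirichletBound
import Literature.NumberTheory.LFunctions.SiegelExceptionalZeroBound
import Literature.NumberTheory.LFunctions.DirichletLFunctionBounds
import Literature.Analysis.Complex.CahenMellinDirichlet
import Literature.Analysis.Complex.VerticalLineIntegrals
import Literature.NumberTheory.LFunctions.ZetaClassicalRegionBounds
import Mathlib.NumberTheory.LSeries.DirichletContinuation
import Mathlib.NumberTheory.LSeries.Dirichlet
import HarnessLib

/-!
# Log-free zero density for one character, I: the mollified coefficients and zero detection

Topic `Literature/NumberTheory/LFunctions`, sub-namespace `LFDSingle`. Everything here is PROVED.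
This is the zero-detecting device of Graham and Heath-Brown (*Zero-free regions for Dirichlet
`L`-functions, and the least prime in an arithmetic progression*, PLMS 64 (1992), §11,
(11.8)–(11.10)) for a single primitive character `χ mod q`: with Graham's two-level weights
`ψ` (levels `U < V`) and one-level weights `θ` (level `W`) of
`Literature.NumberTheory.Sieve.GrahamWeights`, the coefficients
`c(n) = (ψ∗1)(n) (θ∗1)(n)` (`coef`) satisfy `c(1) = 1`, `c(n) = 0` for `1 < n ≤ U`, and

  `Σ_n c(n) χ(n) n^{-s} = L(s, χ) F(s)`,  `F(s) = Σ_{d,e} ψ_d θ_e χ([d,e]) [d,e]^{-s}`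

(`LSeries_coefChi_eq`). By the Cahen–Mellin integral and a shift of the line of integration
to `re w = −1/4` across `w = 0` — where `L(ρ + w, χ) F Γ(w) X^w` has a removable singularity
because `L(ρ, χ) = 0` — one gets for every zero `ρ = β + iγ` with `3/4 ≤ β < 1`
(`norm_tsum_coefChi_mul_exp_le`)

  `|Σ_n c(n) χ(n) n^{-ρ} e^{-n/X}| ≤ C₀ (1 + |γ|) (1 + log q) ⌊V⌋⌊W⌋ q^{5/4 − β} X^{-1/4}`,

Heath-Brown's (11.9) with the trivial growth exponent `φ = 1` (the tree's hybrid bound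
`Siegel.norm_LFunction_le_rpow`) and crude constants.

## References
* D. R. Heath-Brown, PLMS 64 (1992), §11, (11.6)–(11.10). [cite: HeathBrown1992PLMS, §11]
-/

noncomputable section

open Finset Real Complex MeasureTheory ArithmeticFunction
open Literature.NumberTheory.Sieve Literature.NumberTheory.Sieve.GrahamWeights

open scoped ArithmeticFunction.Moebius

namespace Literature.NumberTheory.LFunctions.LFDSingle

variable {q : ℕ} (χ : DirichletCharacter ℂ q)
variable {U V W : ℝ}

/-! ### The coefficients -/

/-- `c(n) = (ψ∗1)(n) (θ∗1)(n)` with Graham's two-level `ψ` (levels `U, V`) and one-level `θ`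
(level `W`; `θ = ψ` with `U = 1`). [cite: HeathBrown1992PLMS, §11 (11.8)] -/
def coef (U V W : ℝ) (n : ℕ) : ℝ := psiStar U V n * psiStar 1 W n

/-- `c(1) = 1`. [cite: HeathBrown1992PLMS, §11 (11.10)] -/
theorem coef_one (hU : 1 ≤ U) (hUV : U < V) (hW : 1 < W) : coef U V W 1 = 1 := by
  rw [coef, psiStar_one hU hUV, psiStar_one le_rfl hW, mul_one]

/-- `c(n) = 0` for `1 < n ≤ U`. [cite: HeathBrown1992PLMS, §11 (11.10)] -/
theorem coef_eq_zero (hU : 1 ≤ U) (hUV : U < V) {n : ℕ} (hn1 : 1 < n) (hnU : (n : ℝ) ≤ U) :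
    coef U V W n = 0 := by
  rw [coef, psiStar_eq_zero (by linarith) hUV hn1 hnU, zero_mul]

/-- `|(ψ∗1)(n)| ≤ ⌊V⌋` (at most `⌊V⌋` divisors `d ≤ V`, each with `|ψ_d| ≤ 1`). [folklore] -/
theorem abs_psiStar_le (hU : 0 < U) (hUV : U < V) (n : ℕ) : |psiStar U V n| ≤ ⌊V⌋₊ := by
  rcases eq_or_ne n 0 with rfl | hn
  · rw [psiStar_zero, abs_zero]; positivity
  rw [psiStar_eq_sum_filter hU hUV.le le_rfl hn]
  calc |∑ d ∈ (Icc 1 ⌊V⌋₊).filter (· ∣ n), psi U V d|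
      ≤ ∑ d ∈ (Icc 1 ⌊V⌋₊).filter (· ∣ n), |psi U V d| := abs_sum_le_sum_abs _ _
    _ ≤ ∑ d ∈ (Icc 1 ⌊V⌋₊).filter (· ∣ n), (1 : ℝ) := sum_le_sum fun d _ => abs_psi_le_one hU hUV d
    _ ≤ ∑ d ∈ Icc 1 ⌊V⌋₊, (1 : ℝ) :=
        sum_le_sum_of_subset_of_nonneg (filter_subset _ _) fun _ _ _ => zero_le_one
    _ = ⌊V⌋₊ := by simp

/-- `|c(n)| ≤ ⌊V⌋ ⌊W⌋`. [folklore] -/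
theorem abs_coef_le (hU : 1 ≤ U) (hUV : U < V) (hW : 1 < W) (n : ℕ) :
    |coef U V W n| ≤ (⌊V⌋₊ : ℝ) * ⌊W⌋₊ := by
  rw [coef, abs_mul]
  exact mul_le_mul (abs_psiStar_le (by linarith) hUV n) (abs_psiStar_le one_pos hW n)
    (abs_nonneg _) (by positivity)

/-! ### The Dirichlet polynomial `F` -/

/-- `F(s) = Σ_{d ≤ ⌊V⌋, e ≤ ⌊W⌋} ψ_d θ_e χ([d,e]) [d,e]^{-s}`. [cite: HeathBrown1992PLMS, §11 (11.8)] -/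
def Fpoly (U V W : ℝ) (s : ℂ) : ℂ :=
  ∑ d ∈ Icc 1 ⌊V⌋₊, ∑ e ∈ Icc 1 ⌊W⌋₊,
    ((psi U V d * psi 1 W e : ℝ) : ℂ) * χ (Nat.lcm d e : ℕ) * ((Nat.lcm d e : ℕ) : ℂ) ^ (-s)

/-- `‖F(s)‖ ≤ ⌊V⌋ ⌊W⌋` for `re s ≥ 0`. [folklore] -/
theorem norm_Fpoly_le (hU : 1 ≤ U) (hUV : U < V) (hW : 1 < W) {s : ℂ} (hs : 0 ≤ s.re) :
    ‖Fpoly χ U V W s‖ ≤ (⌊V⌋₊ : ℝ) * ⌊W⌋₊ := by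
  have hterm : ∀ d ∈ Icc 1 ⌊V⌋₊, ∀ e ∈ Icc 1 ⌊W⌋₊,
      ‖((psi U V d * psi 1 W e : ℝ) : ℂ) * χ (Nat.lcm d e : ℕ) * ((Nat.lcm d e : ℕ) : ℂ) ^ (-s)‖ ≤ 1 := by
    intro d hd e he
    have hd0 : 0 < d := (mem_Icc.1 hd).1
    have he0 : 0 < e := (mem_Icc.1 he).1
    have hl : 0 < Nat.lcm d e := Nat.pos_of_ne_zero (Nat.lcm_ne_zero hd0.ne' he0.ne')
    have hl1 : (1 : ℝ) ≤ (Nat.lcm d e : ℕ) := by exact_mod_cast hl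
    rw [norm_mul, norm_mul, Complex.norm_real, Real.norm_eq_abs, abs_mul,
      Complex.norm_natCast_cpow_of_pos hl]
    have h1 : |psi U V d| * |psi 1 W e| ≤ 1 :=
      mul_le_one₀ (abs_psi_le_one (by linarith) hUV d) (abs_nonneg _) (abs_psi_le_one one_pos hW e)
    have h2 : ‖χ (Nat.lcm d e : ℕ)‖ ≤ 1 := DirichletCharacter.norm_le_one χ _
    have h3 : ((Nat.lcm d e : ℕ) : ℝ) ^ (-s).re ≤ 1 := by
      rw [Complex.neg_re]
      exact Real.rpow_le_one_of_one_le_of_nonpos hl1 (by linarith)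
    have h4 := mul_le_mul (mul_le_mul h1 h2 (norm_nonneg _) zero_le_one) h3
      (by positivity) (by norm_num)
    linarith
  calc ‖Fpoly χ U V W s‖ ≤ ∑ d ∈ Icc 1 ⌊V⌋₊, ‖∑ e ∈ Icc 1 ⌊W⌋₊,
        ((psi U V d * psi 1 W e : ℝ) : ℂ) * χ (Nat.lcm d e : ℕ) * ((Nat.lcm d e : ℕ) : ℂ) ^ (-s)‖ :=
        norm_sum_le _ _
    _ ≤ ∑ d ∈ Icc 1 ⌊V⌋₊, ∑ e ∈ Icc 1 ⌊W⌋₊, (1 : ℝ) :=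
        sum_le_sum fun d hd => (norm_sum_le _ _).trans (sum_le_sum fun e he => hterm d hd e he)
    _ = (⌊V⌋₊ : ℝ) * ⌊W⌋₊ := by simp

/-- `F` is entire. [folklore] -/
theorem differentiable_Fpoly : Differentiable ℂ (Fpoly χ U V W) := by
  unfold Fpoly
  refine Differentiable.fun_sum fun d hd => Differentiable.fun_sum fun e he => ?_
  refine (differentiable_const _).mul ?_
  have hd0 : 0 < d := (mem_Icc.1 hd).1
  have he0 : 0 < e := (mem_Icc.1 he).1
  have hl : (Nat.lcm d e : ℂ) ≠ 0 := by exact_mod_cast Nat.lcm_ne_zero hd0.ne' he0.ne'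
  exact (differentiable_id.neg).const_cpow (Or.inl hl)

/-- `F` is continuous. [folklore] -/
theorem continuous_Fpoly : Continuous (Fpoly χ U V W) := (differentiable_Fpoly χ).continuous

/-! ### The `L`-series identity -/

/-- A complex series supported on the multiples of `k ≥ 1` is a series over `m ↦ km`. [folklore] -/
theorem tsum_ite_dvd_eq_complex {k : ℕ} (hk : 0 < k) (G : ℕ → ℂ) :
    ∑' n : ℕ, (if k ∣ n then G n else 0) = ∑' m : ℕ, G (k * m) := by
  have hinj : Function.Injective (fun m : ℕ => k * m) := fun a b h => Nat.eq_of_mul_eq_mul_left hk h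
  rw [← hinj.tsum_eq]
  · exact tsum_congr fun m => by simp
  · intro n hn
    rw [Function.mem_support] at hn
    by_cases h : k ∣ n
    · obtain ⟨m, rfl⟩ := h
      exact ⟨m, rfl⟩
    · exact absurd (if_neg h) hn

/-- `Σ_{n : k ∣ n} χ(n) n^{-s} = χ(k) k^{-s} L(s, χ)` (as series; `k ≥ 1`). [folklore] -/
theorem tsum_ite_dvd_chi_eq {k : ℕ} (hk : 0 < k) (s : ℂ) :
    ∑' n : ℕ, (if k ∣ n then LSeries.term (fun n => χ n) s n else 0) =
      χ k * (k : ℂ) ^ (-s) * LSeries (fun n => χ n) s := by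
  rw [tsum_ite_dvd_eq_complex hk, LSeries, ← tsum_mul_left]
  refine tsum_congr fun m => ?_
  rcases eq_or_ne m 0 with rfl | hm
  · simp
  have hkm : k * m ≠ 0 := mul_ne_zero hk.ne' hm
  rw [LSeries.term_of_ne_zero hkm, LSeries.term_of_ne_zero hm, Nat.cast_mul, map_mul,
    Nat.cast_mul, Complex.natCast_mul_natCast_cpow, Complex.cpow_neg]
  field_simp

/-- Summability of the series over multiples. [folklore] -/
theorem summable_ite_dvd_chi (k : ℕ) {s : ℂ} (hs : 1 < s.re) :
    Summable fun n : ℕ => if k ∣ n then LSeries.term (fun n => χ n) s n else 0 := by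
  have h := (DirichletCharacter.LSeriesSummable_of_one_lt_re χ hs).norm
  refine Summable.of_norm_bounded h fun n => ?_
  split_ifs
  · exact le_rfl
  · simp

/-- The `n`-th term of `Σ c(n) χ(n) n^{-s}` as a double sum over `d, e`. [folklore] -/
theorem term_coefChi_eq (hU : 1 ≤ U) (hUV : U < V) (hW : 1 < W) (s : ℂ) (n : ℕ) :
    LSeries.term (fun n => (coef U V W n : ℂ) * χ n) s n =
      ∑ d ∈ Icc 1 ⌊V⌋₊, ∑ e ∈ Icc 1 ⌊W⌋₊, ((psi U V d * psi 1 W e : ℝ) : ℂ) *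
        (if Nat.lcm d e ∣ n then LSeries.term (fun n => χ n) s n else 0) := by
  rcases eq_or_ne n 0 with rfl | hn
  · simp
  have hU0 : 0 < U := by linarith
  rw [LSeries.term_of_ne_zero hn, coef, psiStar_eq_sum_filter hU0 hUV.le le_rfl hn,
    psiStar_eq_sum_filter one_pos hW.le le_rfl hn, sum_filter, sum_filter]
  push_cast
  rw [sum_mul_sum, sum_mul, sum_div]
  refine sum_congr rfl fun d _ => ?_
  rw [sum_mul, sum_div]
  refine sum_congr rfl fun e _ => ?_
  have hiff : Nat.lcm d e ∣ n ↔ d ∣ n ∧ e ∣ n := Nat.lcm_dvd_iff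
  by_cases hd : d ∣ n
  · by_cases he : e ∣ n
    · simp [hd, he, hiff, LSeries.term_of_ne_zero hn]; ring
    · simp [hd, he, hiff]
  · simp [hd, hiff]


/-- Summability of `Σ c(n) χ(n) n^{-s}` for `re s > 1`. [folklore] -/
theorem LSeriesSummable_coefChi (hU : 1 ≤ U) (hUV : U < V) (hW : 1 < W) {s : ℂ} (hs : 1 < s.re) :
    LSeriesSummable (fun n => (coef U V W n : ℂ) * χ n) s := by
  refine LSeriesSummable_of_bounded_of_one_lt_re (m := (⌊V⌋₊ : ℝ) * ⌊W⌋₊) (fun n _ => ?_) hs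
  rw [norm_mul, Complex.norm_real, Real.norm_eq_abs]
  calc |coef U V W n| * ‖χ n‖ ≤ (⌊V⌋₊ : ℝ) * ⌊W⌋₊ * 1 :=
        mul_le_mul (abs_coef_le hU hUV hW n) (DirichletCharacter.norm_le_one χ _) (norm_nonneg _)
          (by positivity)
    _ = _ := mul_one _

/-- **The `L`-series identity**: for `re s > 1`,
`Σ_n c(n) χ(n) n^{-s} = L(s, χ) F(s)`. [cite: HeathBrown1992PLMS, §11 (11.8)] -/
theorem LSeries_coefChi_eq [NeZero q] (hU : 1 ≤ U) (hUV : U < V) (hW : 1 < W) {s : ℂ}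
    (hs : 1 < s.re) :
    LSeries (fun n => (coef U V W n : ℂ) * χ n) s = χ.LFunction s * Fpoly χ U V W s := by
  rw [LSeries, tsum_congr (term_coefChi_eq χ hU hUV hW s)]
  rw [Summable.tsum_finsetSum fun d _ => summable_sum fun e _ =>
    (summable_ite_dvd_chi χ _ hs).mul_left _]
  rw [DirichletCharacter.LFunction_eq_LSeries χ hs, Fpoly, mul_sum]
  refine sum_congr rfl fun d hd => ?_
  rw [Summable.tsum_finsetSum fun e _ => (summable_ite_dvd_chi χ _ hs).mul_left _, mul_sum]
  refine sum_congr rfl fun e he => ?_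
  have hd0 : 0 < d := (mem_Icc.1 hd).1
  have he0 : 0 < e := (mem_Icc.1 he).1
  have hl : 0 < Nat.lcm d e := Nat.pos_of_ne_zero (Nat.lcm_ne_zero hd0.ne' he0.ne')
  rw [tsum_mul_left, tsum_ite_dvd_chi_eq χ hl]
  ring

/-! ### The shifted coefficients `b_ρ(n) = c(n) χ(n) n^{-ρ}` -/

/-- `b_ρ(n) = c(n) χ(n) n^{-ρ}`. [folklore] -/
def bcoef (U V W : ℝ) (ρ : ℂ) (n : ℕ) : ℂ := (coef U V W n : ℂ) * χ n * (n : ℂ) ^ (-ρ)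

/-- `term b_ρ w n = term (c χ) (ρ + w) n`. [folklore] -/
theorem term_bcoef (ρ w : ℂ) (n : ℕ) :
    LSeries.term (bcoef χ U V W ρ) w n = LSeries.term (fun n => (coef U V W n : ℂ) * χ n) (ρ + w) n := by
  rcases eq_or_ne n 0 with rfl | hn
  · simp
  have hn' : (n : ℂ) ≠ 0 := Nat.cast_ne_zero.2 hn
  rw [LSeries.term_of_ne_zero hn, LSeries.term_of_ne_zero hn, bcoef, Complex.cpow_add _ _ hn',
    Complex.cpow_neg]
  field_simp

/-- `L(b_ρ, w) = L(cχ, ρ + w)`. [folklore] -/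
theorem LSeries_bcoef (ρ w : ℂ) :
    LSeries (bcoef χ U V W ρ) w = LSeries (fun n => (coef U V W n : ℂ) * χ n) (ρ + w) :=
  tsum_congr (term_bcoef χ ρ w)

/-- Summability of `L(b_ρ, c)` for `c > 1 − re ρ`. [folklore] -/
theorem LSeriesSummable_bcoef (hU : 1 ≤ U) (hUV : U < V) (hW : 1 < W) (ρ : ℂ) {c : ℝ}
    (hc : 1 - ρ.re < c) : LSeriesSummable (bcoef χ U V W ρ) c := by
  refine LSeriesSummable_of_le_const_mul_rpow (x := 1 - ρ.re) (by simpa using hc)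
    ⟨(⌊V⌋₊ : ℝ) * ⌊W⌋₊, fun n hn => ?_⟩
  have hn0 : 0 < n := Nat.pos_of_ne_zero hn
  rw [bcoef, norm_mul, norm_mul, Complex.norm_real, Real.norm_eq_abs,
    Complex.norm_natCast_cpow_of_pos hn0, Complex.neg_re, show (1 - ρ.re - 1 : ℝ) = -ρ.re by ring]
  refine mul_le_mul_of_nonneg_right ?_ (by positivity)
  calc |coef U V W n| * ‖χ n‖ ≤ (⌊V⌋₊ : ℝ) * ⌊W⌋₊ * 1 :=
        mul_le_mul (abs_coef_le hU hUV hW n) (DirichletCharacter.norm_le_one χ _) (norm_nonneg _)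
          (by positivity)
    _ = _ := mul_one _

/-! ### The contour integrand -/

/-- `G(w) = L(ρ + w, χ) F(ρ + w) X^w Γ(w)`. [cite: HeathBrown1992PLMS, §11 (11.8)] -/
def detIntegrand [NeZero q] (U V W X : ℝ) (ρ w : ℂ) : ℂ :=
  χ.LFunction (ρ + w) * Fpoly χ U V W (ρ + w) * (X : ℂ) ^ w * Complex.Gamma w

/-- The pole-free numerator `φ(w) = L(ρ + w, χ) F(ρ + w) X^w Γ(w + 1)`, so that `G = φ/w`.
[folklore] -/
def detNumer [NeZero q] (U V W X : ℝ) (ρ w : ℂ) : ℂ :=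
  χ.LFunction (ρ + w) * Fpoly χ U V W (ρ + w) * (X : ℂ) ^ w * Complex.Gamma (w + 1)

/-- `G(w) = φ(w)/w` for `w ≠ 0` (`Γ(w+1) = w Γ(w)`). [folklore] -/
theorem detIntegrand_eq_div [NeZero q] (U V W X : ℝ) (ρ : ℂ) {w : ℂ} (hw : w ≠ 0) :
    detIntegrand χ U V W X ρ w = detNumer χ U V W X ρ w / (w - 0) := by
  rw [sub_zero, detNumer, Complex.Gamma_add_one w hw, detIntegrand]
  field_simp

/-- `φ` is differentiable on `re w > −1` when `χ ≠ 1`. [folklore] -/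
theorem differentiableOn_detNumer [NeZero q] (hχ : χ ≠ 1) (U V W : ℝ) {X : ℝ} (hX : 0 < X)
    (ρ : ℂ) :
    DifferentiableOn ℂ (detNumer χ U V W X ρ) {w : ℂ | -1 < w.re} := by
  intro w hw
  have h1 : DifferentiableAt ℂ (fun w => χ.LFunction (ρ + w)) w :=
    ((DirichletCharacter.differentiable_LFunction hχ) (ρ + w)).comp w
      ((differentiableAt_const _).add differentiableAt_id)
  have h2 : DifferentiableAt ℂ (fun w => Fpoly χ U V W (ρ + w)) w :=
    ((differentiable_Fpoly χ) (ρ + w)).comp w ((differentiableAt_const _).add differentiableAt_id)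
  have h3 : DifferentiableAt ℂ (fun w => (X : ℂ) ^ w) w :=
    differentiableAt_id.const_cpow (Or.inl (by exact_mod_cast hX.ne'))
  have h4 : DifferentiableAt ℂ (fun w => Complex.Gamma (w + 1)) w := by
    refine (Complex.differentiableAt_Gamma _ fun m => ?_).comp w (differentiableAt_id.add_const 1)
    intro h
    have := congrArg Complex.re h
    simp at this
    have hw' : -1 < w.re := hw
    linarith
  exact (((h1.mul h2).mul h3).mul h4).differentiableWithinAt

/-- `G` is differentiable on `{re w > −1} ∖ {0}` when `χ ≠ 1`. [folklore] -/
theorem differentiableOn_detIntegrand [NeZero q] (hχ : χ ≠ 1) (U V W : ℝ) {X : ℝ} (hX : 0 < X)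
    (ρ : ℂ) :
    DifferentiableOn ℂ (detIntegrand χ U V W X ρ) ({w : ℂ | -1 < w.re} \ {0}) := by
  have h := (differentiableOn_detNumer χ hχ U V W hX ρ)
  intro w hw
  have hw0 : w ≠ 0 := hw.2
  have heq : ∀ z ∈ ({w : ℂ | -1 < w.re} \ {0} : Set ℂ),
      detIntegrand χ U V W X ρ z = detNumer χ U V W X ρ z / z := by
    intro z hz
    rw [detIntegrand_eq_div χ U V W X ρ (show z ≠ 0 from hz.2), sub_zero]
  refine (DifferentiableWithinAt.congr ?_ (fun z hz => heq z hz) (heq w hw))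
  exact ((h w hw.1).mono fun z hz => hz.1).div (differentiableWithinAt_id) hw0


/-! ### Norm estimates for `Γ` and for the integrand -/

/-- `(1 + u)^5 e^{-πu/2} ≤ 1024` for `u ≥ 0` (`1 + u ≤ 4e^{u/4}`, `5/4 < π/2`). [folklore] -/
theorem one_add_pow_five_mul_exp_le {u : ℝ} (hu : 0 ≤ u) :
    (1 + u) ^ 5 * Real.exp (-(π * u) / 2) ≤ 1024 := by
  have h1 : 1 + u ≤ 4 * Real.exp (u / 4) := by
    have := Real.add_one_le_exp (u / 4)
    linarith
  have h2 : (1 + u) ^ 5 ≤ 1024 * Real.exp (5 * u / 4) := by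
    calc (1 + u) ^ 5 ≤ (4 * Real.exp (u / 4)) ^ 5 := by gcongr
      _ = 1024 * Real.exp (5 * u / 4) := by
          rw [mul_pow, ← Real.exp_nat_mul]; norm_num; ring_nf
  have h3 : Real.exp (5 * u / 4) * Real.exp (-(π * u) / 2) ≤ 1 := by
    rw [← Real.exp_add, Real.exp_le_one_iff]
    have := Real.pi_gt_three
    nlinarith
  calc (1 + u) ^ 5 * Real.exp (-(π * u) / 2)
      ≤ 1024 * Real.exp (5 * u / 4) * Real.exp (-(π * u) / 2) :=
        mul_le_mul_of_nonneg_right h2 (Real.exp_nonneg _)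
    _ = 1024 * (Real.exp (5 * u / 4) * Real.exp (-(π * u) / 2)) := by ring
    _ ≤ 1024 * 1 := by gcongr
    _ = 1024 := by ring

/-- The Gamma majorant `(1+|y|)^{5/2} e^{-π|y|/2} ≤ 1024 (1 + y²)⁻¹`. [folklore] -/
theorem rpow_mul_exp_le_inv_one_add_sq (y : ℝ) :
    (1 + |y|) ^ (5 / 2 : ℝ) * Real.exp (-(π * |y|) / 2) ≤ 1024 * (1 + y ^ 2)⁻¹ := by
  have hy : 0 ≤ |y| := abs_nonneg y
  have h1 : 1 ≤ 1 + |y| := by linarith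
  have hsq : 1 + y ^ 2 ≤ (1 + |y|) ^ 2 := by rw [← sq_abs y]; nlinarith
  have hpos : 0 < 1 + y ^ 2 := by positivity
  rw [← div_eq_mul_inv, le_div_iff₀ hpos]
  have hrpow : (1 + |y|) ^ (5 / 2 : ℝ) ≤ (1 + |y|) ^ (3 : ℝ) :=
    Real.rpow_le_rpow_of_exponent_le h1 (by norm_num)
  calc (1 + |y|) ^ (5 / 2 : ℝ) * Real.exp (-(π * |y|) / 2) * (1 + y ^ 2)
      ≤ (1 + |y|) ^ (3 : ℝ) * Real.exp (-(π * |y|) / 2) * (1 + |y|) ^ 2 :=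
        mul_le_mul (mul_le_mul_of_nonneg_right hrpow (Real.exp_nonneg _)) hsq (by positivity)
          (by positivity)
    _ = (1 + |y|) ^ 5 * Real.exp (-(π * |y|) / 2) := by
        rw [show (3 : ℝ) = ((3 : ℕ) : ℝ) by norm_num, Real.rpow_natCast]; ring
    _ ≤ 1024 := one_add_pow_five_mul_exp_le hy

/-- One step down: `‖Γ(x + iy)‖ ≤ 16π²(1+|y|)^{3/2}e^{-π|y|/2} / ‖x + iy‖` for `0 ≤ x ≤ 1`,
`x + iy ≠ 0`. [folklore] -/
theorem norm_Gamma_le_step {x : ℝ} (h0 : 0 ≤ x) (h1 : x ≤ 1) {y : ℝ} (hne : (x : ℂ) + y * I ≠ 0) :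
    ‖Complex.Gamma (x + y * I)‖ ≤
      16 * π ^ 2 * (1 + |y|) ^ (3 / 2 : ℝ) * Real.exp (-(π * |y|) / 2) / ‖(x : ℂ) + y * I‖ := by
  have hG := Complex.Gamma_add_one _ hne
  have heq : Complex.Gamma (x + y * I) = Complex.Gamma ((x : ℂ) + y * I + 1) / ((x : ℂ) + y * I) := by
    rw [hG]; field_simp
  rw [heq, norm_div]
  refine div_le_div_of_nonneg_right ?_ (norm_nonneg _)
  have := Literature.Analysis.SpecialFunctions.norm_Gamma_le_of_mem_Icc (x := x + 1) (by linarith) (by linarith) y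
  rw [show ((x + 1 : ℝ) : ℂ) + y * I = (x : ℂ) + y * I + 1 by push_cast; ring] at this
  exact this

/-- Two steps down: for `-1 ≤ x ≤ 0`, `x + iy ∉ {0, -1}`:
`‖Γ(x + iy)‖ ≤ 16π²(1+|y|)^{3/2}e^{-π|y|/2} / (‖x + iy‖ ‖x + 1 + iy‖)`. [folklore] -/
theorem norm_Gamma_le_step₂ {x : ℝ} (h0 : -1 ≤ x) (h1 : x ≤ 0) {y : ℝ} (hne : (x : ℂ) + y * I ≠ 0)
    (hne1 : (x : ℂ) + y * I + 1 ≠ 0) :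
    ‖Complex.Gamma (x + y * I)‖ ≤
      16 * π ^ 2 * (1 + |y|) ^ (3 / 2 : ℝ) * Real.exp (-(π * |y|) / 2) /
        (‖(x : ℂ) + y * I‖ * ‖(x : ℂ) + y * I + 1‖) := by
  have hG := Complex.Gamma_add_one _ hne
  have heq : Complex.Gamma (x + y * I) = Complex.Gamma ((x : ℂ) + y * I + 1) / ((x : ℂ) + y * I) := by
    rw [hG]; field_simp
  rw [heq, norm_div, mul_comm (‖(x : ℂ) + y * I‖), ← div_div]
  refine div_le_div_of_nonneg_right ?_ (norm_nonneg _)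
  have h := norm_Gamma_le_step (x := x + 1) (by linarith) (by linarith) (y := y)
    (by rw [show ((x + 1 : ℝ) : ℂ) + y * I = (x : ℂ) + y * I + 1 by push_cast; ring]; exact hne1)
  rw [show ((x + 1 : ℝ) : ℂ) + y * I = (x : ℂ) + y * I + 1 by push_cast; ring] at h
  exact h

/-- `Σ_{n ≥ 0} (n+1)^{-ω} ≤ ω/(ω−1)` for `ω > 1`. [folklore] -/
theorem tsum_succ_rpow_neg_le {ω : ℝ} (hω : 1 < ω) :
    ∑' n : ℕ, ((n + 1 : ℕ) : ℝ) ^ (-ω) ≤ ω / (ω - 1) := by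
  have hs := GrahamWeights.summable_rpow_neg hω
  have h0 : ((0 : ℕ) : ℝ) ^ (-ω) = 0 := by
    rw [Nat.cast_zero, Real.zero_rpow (neg_ne_zero.2 (by linarith))]
  have := hs.tsum_eq_zero_add
  rw [h0, zero_add] at this
  rw [← this]
  exact GrahamWeights.tsum_rpow_neg_le hω

variable [NeZero q]

/-- **`‖L(s, χ)‖` slightly to the left of `1`** (trivial growth exponent): for `χ ≠ 1`, `q ≥ 2`,
`1/2 ≤ re s ≤ 1` (`q ≥ 8`, so that `log q > 2`): `‖L(s, χ)‖ ≤ e q^{1 − re s} (log q + 1) ‖s‖`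
(the tree's hybrid bound with `δ = 1 − σ + 1/log q`). [cite: MontgomeryVaughan2007, §10.2 Lemma 10.15] -/
theorem norm_LFunction_le_left (hχ : χ ≠ 1) (hq : 8 ≤ q) {s : ℂ} (hs : 1 / 2 ≤ s.re) (hs1 : s.re ≤ 1) :
    ‖χ.LFunction s‖ ≤ Real.exp 1 * (q : ℝ) ^ (1 - s.re) * (Real.log q + 1) * ‖s‖ := by
  have hq' : (8 : ℝ) ≤ q := by exact_mod_cast hq
  have hlog8 : (2 : ℝ) < Real.log q := by
    have h8 : (2 : ℝ) < Real.log 8 := by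
      rw [Real.lt_log_iff_exp_lt (by norm_num)]
      have h1 := Real.exp_one_lt_d9
      have : Real.exp 2 = Real.exp 1 * Real.exp 1 := by rw [← Real.exp_add]; norm_num
      rw [this]; nlinarith [Real.exp_pos 1]
    exact h8.trans_le (Real.log_le_log (by norm_num) hq')
  have hL : 0 < Real.log q := by linarith
  set δ : ℝ := 1 - s.re + 1 / Real.log q with hδ
  have hδ0 : 0 ≤ δ := by rw [hδ]; have := one_div_pos.2 hL; linarith
  have hδ1 : δ ≤ 1 := by
    rw [hδ]
    have : 1 / Real.log q ≤ 1 / 2 := by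
      rw [div_le_div_iff₀ hL two_pos]; linarith
    linarith
  have h := Siegel.norm_LFunction_le_rpow χ hχ hδ0 hδ1 (by linarith) (by rw [hδ]; have := one_div_pos.2 hL; linarith)
  have hω : s.re + δ = 1 + 1 / Real.log q := by rw [hδ]; ring
  rw [hω] at h
  have hsum : ∑' n : ℕ, ((n + 1 : ℕ) : ℝ) ^ (-(1 + 1 / Real.log q)) ≤ Real.log q + 1 := by
    refine (tsum_succ_rpow_neg_le (by have := one_div_pos.2 hL; linarith)).trans (le_of_eq ?_)
    field_simp
    ring
  have hqpow : (q : ℝ) ^ δ = Real.exp 1 * (q : ℝ) ^ (1 - s.re) := by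
    rw [hδ, Real.rpow_add (by linarith), mul_comm]
    congr 1
    rw [Real.rpow_def_of_pos (by linarith), one_div, mul_inv_cancel₀ hL.ne']
  rw [hqpow] at h
  calc ‖χ.LFunction s‖ ≤ Real.exp 1 * (q : ℝ) ^ (1 - s.re) * ‖s‖ *
        ∑' n : ℕ, ((n + 1 : ℕ) : ℝ) ^ (-(1 + 1 / Real.log q)) := h
    _ ≤ Real.exp 1 * (q : ℝ) ^ (1 - s.re) * ‖s‖ * (Real.log q + 1) := by gcongr
    _ = _ := by ring

/-- `‖L(s, χ)‖ ≤ 5 q ‖s‖` for `χ ≠ 1`, `re s ≥ 1/4` (the tree's crude bound, with `Σ (n+1)^{-5/4} ≤ 5`).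
[cite: MontgomeryVaughan2007, §10.2 Lemma 10.15] -/
theorem norm_LFunction_le_crude' (hχ : χ ≠ 1) {s : ℂ} (hs : 1 / 4 ≤ s.re) :
    ‖χ.LFunction s‖ ≤ 5 * q * ‖s‖ := by
  have h := DirichletZFR.norm_LFunction_le_of_re_ge χ hχ hs
  have hZ : ∑' n : ℕ, ((n + 1 : ℕ) : ℝ) ^ (-(5 / 4 : ℝ)) ≤ 5 := by
    refine (tsum_succ_rpow_neg_le (by norm_num)).trans ?_; norm_num
  calc ‖χ.LFunction s‖ ≤ q * ‖s‖ * ∑' n : ℕ, ((n + 1 : ℕ) : ℝ) ^ (-(5 / 4 : ℝ)) := h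
    _ ≤ q * ‖s‖ * 5 := by gcongr
    _ = 5 * q * ‖s‖ := by ring

/-- `‖L(s, χ)‖ ≤ 3` for `re s ≥ 3/2` (term-wise comparison with `ζ(3/2)·` — precisely
`‖L(s,χ)‖ ≤ σ/(σ−1) ≤ 3`). [folklore] -/
theorem norm_LFunction_le_three {s : ℂ} (hs : 3 / 2 ≤ s.re) : ‖χ.LFunction s‖ ≤ 3 := by
  have hs1 : 1 < s.re := by linarith
  rw [DirichletCharacter.LFunction_eq_LSeries χ hs1]
  refine (ZetaClassicalRegion.norm_LSeries_le_of_norm_le_one (fun n => DirichletCharacter.norm_le_one χ _) hs1).trans ?_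
  rw [div_le_iff₀ (by linarith)]; linarith

/-! ### Continuity and integrability along the two lines -/

variable {X : ℝ}

/-- Continuity of `y ↦ G(x + iy)` for `x ∉ -ℕ` (`χ ≠ 1`, `X > 0`). [folklore] -/
theorem continuous_detIntegrand_line (hχ : χ ≠ 1) (hX : 0 < X) (ρ : ℂ) {x : ℝ}
    (hx : ∀ m : ℕ, x ≠ -m) :
    Continuous fun y : ℝ => detIntegrand χ U V W X ρ (x + y * I) := by
  have hline : Continuous fun y : ℝ => (x : ℂ) + y * I := by fun_prop
  unfold detIntegrand
  refine ((Continuous.mul (Continuous.mul ?_ ?_) ?_).mul ?_)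
  · exact (DirichletCharacter.differentiable_LFunction hχ).continuous.comp (continuous_const.add hline)
  · exact (continuous_Fpoly χ).comp (continuous_const.add hline)
  · exact Continuous.const_cpow hline (Or.inl (by exact_mod_cast hX.ne'))
  · refine continuous_iff_continuousAt.2 fun y => ?_
    refine (Complex.differentiableAt_Gamma _ fun m h => ?_).continuousAt.comp hline.continuousAt
    have h1 := congrArg Complex.re h
    have h2 := congrArg Complex.im h
    simp at h1 h2
    exact hx m (by rw [h1])

/-- The norm of the integrand on the right line `re w = 1`:
`‖G(1 + iy)‖ ≤ 3 ⌊V⌋⌊W⌋ X · 16π²(1+|y|)^{3/2}e^{-π|y|/2}` (`re ρ ≥ 1/2`, `X ≥ 1`). [folklore] -/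
theorem norm_detIntegrand_right_le (hU : 1 ≤ U) (hUV : U < V) (hW : 1 < W) (hX : 1 ≤ X) {ρ : ℂ}
    (hρ : 1 / 2 ≤ ρ.re) (y : ℝ) :
    ‖detIntegrand χ U V W X ρ (1 + y * I)‖ ≤
      3 * ((⌊V⌋₊ : ℝ) * ⌊W⌋₊) * X * (16 * π ^ 2 * (1 + |y|) ^ (3 / 2 : ℝ) * Real.exp (-(π * |y|) / 2)) := by
  unfold detIntegrand
  have hre : (ρ + (1 + y * I)).re = ρ.re + 1 := by simp
  have h1 : ‖χ.LFunction (ρ + (1 + y * I))‖ ≤ 3 := norm_LFunction_le_three χ (by rw [hre]; linarith)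
  have h2 : ‖Fpoly χ U V W (ρ + (1 + y * I))‖ ≤ (⌊V⌋₊ : ℝ) * ⌊W⌋₊ :=
    norm_Fpoly_le χ hU hUV hW (by rw [hre]; linarith)
  have h3 : ‖(X : ℂ) ^ (1 + y * I)‖ = X := by
    rw [Complex.norm_cpow_eq_rpow_re_of_pos (by linarith)]; simp
  have h4 := Literature.Analysis.SpecialFunctions.norm_Gamma_le_of_mem_Icc (x := 1) le_rfl (by norm_num) y
  simp only [Complex.ofReal_one] at h4
  rw [norm_mul, norm_mul, norm_mul, h3]
  gcongr

/-- The norm of the integrand on the left line `re w = -1/4`, for a zero `ρ` with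
`3/4 ≤ re ρ ≤ 1` and `q ≥ 8`:
`‖G(-1/4 + iy)‖ ≤ K (1+|y|)^{5/2} e^{-π|y|/2}`,
`K = (256π²e/3) q^{5/4−β}(log q+1)(2+|γ|)⌊V⌋⌊W⌋ X^{-1/4}`. [cite: HeathBrown1992PLMS, §11 (11.9)] -/
theorem norm_detIntegrand_left_le (hχ : χ ≠ 1) (hq : 8 ≤ q) (hU : 1 ≤ U) (hUV : U < V) (hW : 1 < W)
    (hX : 0 < X) {ρ : ℂ} (hρ : 3 / 4 ≤ ρ.re) (hρ1 : ρ.re ≤ 1) (y : ℝ) :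
    ‖detIntegrand χ U V W X ρ ((-1 / 4 : ℝ) + y * I)‖ ≤
      (256 * π ^ 2 * Real.exp 1 / 3 * (q : ℝ) ^ (5 / 4 - ρ.re) * (Real.log q + 1) *
        (2 + |ρ.im|) * ((⌊V⌋₊ : ℝ) * ⌊W⌋₊) * X ^ (-(1 / 4 : ℝ))) *
        ((1 + |y|) ^ (5 / 2 : ℝ) * Real.exp (-(π * |y|) / 2)) := by
  unfold detIntegrand
  set w : ℂ := ((-1 / 4 : ℝ) : ℂ) + y * I with hw
  have hwre : w.re = -1 / 4 := by simp [hw]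
  have hre : (ρ + w).re = ρ.re - 1 / 4 := by rw [Complex.add_re, hwre]; ring
  -- `L`
  have hL : ‖χ.LFunction (ρ + w)‖ ≤
      Real.exp 1 * (q : ℝ) ^ (5 / 4 - ρ.re) * (Real.log q + 1) * ((2 + |ρ.im|) * (1 + |y|)) := by
    have h := norm_LFunction_le_left χ hχ hq (s := ρ + w) (by rw [hre]; linarith) (by rw [hre]; linarith)
    rw [hre, show (1 - (ρ.re - 1 / 4) : ℝ) = 5 / 4 - ρ.re by ring] at h
    refine h.trans (mul_le_mul_of_nonneg_left ?_ (by positivity))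
    calc ‖ρ + w‖ ≤ ‖ρ‖ + ‖w‖ := norm_add_le _ _
      _ ≤ (|ρ.re| + |ρ.im|) + (|(-1 / 4 : ℝ)| + |y|) := by
          gcongr
          · exact Complex.norm_le_abs_re_add_abs_im ρ
          · have := Complex.norm_le_abs_re_add_abs_im w
            simpa [hw] using this
      _ ≤ (2 + |ρ.im|) * (1 + |y|) := by
          rw [abs_of_nonneg (by linarith : (0 : ℝ) ≤ ρ.re)]
          have : |(-1 / 4 : ℝ)| = 1 / 4 := by norm_num [abs_of_neg]
          rw [this]
          nlinarith [abs_nonneg ρ.im, abs_nonneg y]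
  -- `F`, `X^w`
  have hF : ‖Fpoly χ U V W (ρ + w)‖ ≤ (⌊V⌋₊ : ℝ) * ⌊W⌋₊ := norm_Fpoly_le χ hU hUV hW (by rw [hre]; linarith)
  have hXw : ‖(X : ℂ) ^ w‖ = X ^ (-(1 / 4 : ℝ)) := by
    rw [Complex.norm_cpow_eq_rpow_re_of_pos hX, hwre]; norm_num
  -- `Γ`
  have hne : ((-1 / 4 : ℝ) : ℂ) + y * I ≠ 0 := by
    intro h; have := congrArg Complex.re h; simp at this
  have hne1 : ((-1 / 4 : ℝ) : ℂ) + y * I + 1 ≠ 0 := by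
    intro h; have := congrArg Complex.re h; norm_num at this
  have hΓ := norm_Gamma_le_step₂ (x := -1 / 4) (by norm_num) (by norm_num) hne hne1
  have hn1 : (1 / 4 : ℝ) ≤ ‖((-1 / 4 : ℝ) : ℂ) + y * I‖ := by
    have : |(-1 / 4 : ℝ)| ≤ ‖((-1 / 4 : ℝ) : ℂ) + y * I‖ := by
      simpa using Complex.abs_re_le_norm (((-1 / 4 : ℝ) : ℂ) + y * I)
    norm_num [abs_of_neg] at this ⊢
    exact this
  have hn2 : (3 / 4 : ℝ) ≤ ‖((-1 / 4 : ℝ) : ℂ) + y * I + 1‖ := by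
    have : |(3 / 4 : ℝ)| ≤ ‖((3 / 4 : ℝ) : ℂ) + y * I‖ := by
      simpa using Complex.abs_re_le_norm (((3 / 4 : ℝ) : ℂ) + y * I)
    rw [show ((3 / 4 : ℝ) : ℂ) + y * I = ((-1 / 4 : ℝ) : ℂ) + y * I + 1 by push_cast; ring] at this
    norm_num [abs_of_pos] at this ⊢
    exact this
  have hΓ' : ‖Complex.Gamma w‖ ≤ (16 / 3) * (16 * π ^ 2 * (1 + |y|) ^ (3 / 2 : ℝ) * Real.exp (-(π * |y|) / 2)) := by
    rw [hw]
    refine hΓ.trans ?_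
    rw [div_le_iff₀ (by positivity)]
    have hprod : (3 / 16 : ℝ) ≤ ‖((-1 / 4 : ℝ) : ℂ) + y * I‖ * ‖((-1 / 4 : ℝ) : ℂ) + y * I + 1‖ := by
      nlinarith [norm_nonneg (((-1 / 4 : ℝ) : ℂ) + y * I), norm_nonneg (((-1 / 4 : ℝ) : ℂ) + y * I + 1)]
    have h0 : 0 ≤ 16 * π ^ 2 * (1 + |y|) ^ (3 / 2 : ℝ) * Real.exp (-(π * |y|) / 2) := by positivity
    nlinarith
  -- assemble
  rw [norm_mul, norm_mul, norm_mul, hXw]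
  have hy32 : (1 + |y|) * (1 + |y|) ^ (3 / 2 : ℝ) = (1 + |y|) ^ (5 / 2 : ℝ) := by
    rw [← Real.rpow_one_add' (by positivity) (by norm_num)]; norm_num
  calc ‖χ.LFunction (ρ + w)‖ * ‖Fpoly χ U V W (ρ + w)‖ * X ^ (-(1 / 4 : ℝ)) * ‖Complex.Gamma w‖
      ≤ (Real.exp 1 * (q : ℝ) ^ (5 / 4 - ρ.re) * (Real.log q + 1) * ((2 + |ρ.im|) * (1 + |y|))) *
        ((⌊V⌋₊ : ℝ) * ⌊W⌋₊) * X ^ (-(1 / 4 : ℝ)) *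
        ((16 / 3) * (16 * π ^ 2 * (1 + |y|) ^ (3 / 2 : ℝ) * Real.exp (-(π * |y|) / 2))) := by
        gcongr
    _ = (256 * π ^ 2 * Real.exp 1 / 3 * (q : ℝ) ^ (5 / 4 - ρ.re) * (Real.log q + 1) *
        (2 + |ρ.im|) * ((⌊V⌋₊ : ℝ) * ⌊W⌋₊) * X ^ (-(1 / 4 : ℝ))) *
        (((1 + |y|) * (1 + |y|) ^ (3 / 2 : ℝ)) * Real.exp (-(π * |y|) / 2)) := by ring
    _ = _ := by rw [hy32]


/-- Integrability along the right line `re w = 1`. [folklore] -/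
theorem integrable_detIntegrand_right (hχ : χ ≠ 1) (hU : 1 ≤ U) (hUV : U < V) (hW : 1 < W)
    (hX : 1 ≤ X) {ρ : ℂ} (hρ : 1 / 2 ≤ ρ.re) :
    Integrable fun y : ℝ => detIntegrand χ U V W X ρ (1 + y * I) := by
  have hcont := continuous_detIntegrand_line χ (U := U) (V := V) (W := W) (X := X) hχ (by linarith) ρ
    (x := 1) (fun m h => by have : (0 : ℝ) ≤ m := Nat.cast_nonneg m; linarith)
  simp only [Complex.ofReal_one] at hcont
  refine Literature.Analysis.Complex.VLI.integrable_of_continuous_of_norm_le hcont (R := 0)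
    (C := 3 * ((⌊V⌋₊ : ℝ) * ⌊W⌋₊) * X * (16 * π ^ 2) * 1024) fun y _ => ?_
  refine (norm_detIntegrand_right_le χ hU hUV hW hX hρ y).trans ?_
  have h1 : (1 + |y|) ^ (3 / 2 : ℝ) ≤ (1 + |y|) ^ (5 / 2 : ℝ) :=
    Real.rpow_le_rpow_of_exponent_le (by linarith [abs_nonneg y]) (by norm_num)
  have h2 := rpow_mul_exp_le_inv_one_add_sq y
  have h0 : 0 ≤ 3 * ((⌊V⌋₊ : ℝ) * ⌊W⌋₊) * X * (16 * π ^ 2) := by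
    have : (0 : ℝ) ≤ X := by linarith
    positivity
  calc 3 * ((⌊V⌋₊ : ℝ) * ⌊W⌋₊) * X * (16 * π ^ 2 * (1 + |y|) ^ (3 / 2 : ℝ) * Real.exp (-(π * |y|) / 2))
      = 3 * ((⌊V⌋₊ : ℝ) * ⌊W⌋₊) * X * (16 * π ^ 2) * ((1 + |y|) ^ (3 / 2 : ℝ) * Real.exp (-(π * |y|) / 2)) := by ring
    _ ≤ 3 * ((⌊V⌋₊ : ℝ) * ⌊W⌋₊) * X * (16 * π ^ 2) * ((1 + |y|) ^ (5 / 2 : ℝ) * Real.exp (-(π * |y|) / 2)) := by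
        gcongr
    _ ≤ 3 * ((⌊V⌋₊ : ℝ) * ⌊W⌋₊) * X * (16 * π ^ 2) * (1024 * (1 + y ^ 2)⁻¹) :=
        mul_le_mul_of_nonneg_left h2 h0
    _ = _ := by ring

/-- Integrability along the left line `re w = -1/4`. [folklore] -/
theorem integrable_detIntegrand_left (hχ : χ ≠ 1) (hq : 8 ≤ q) (hU : 1 ≤ U) (hUV : U < V) (hW : 1 < W)
    (hX : 0 < X) {ρ : ℂ} (hρ : 3 / 4 ≤ ρ.re) (hρ1 : ρ.re ≤ 1) :
    Integrable fun y : ℝ => detIntegrand χ U V W X ρ ((-1 / 4 : ℝ) + y * I) := by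
  have hcont := continuous_detIntegrand_line χ (U := U) (V := V) (W := W) (X := X) hχ hX ρ
    (x := -1 / 4) (fun m h => by
      have h4 : (4 : ℝ) * m = 1 := by linarith
      have : (4 * m : ℕ) = 1 := by exact_mod_cast h4
      omega)
  set K : ℝ := 256 * π ^ 2 * Real.exp 1 / 3 * (q : ℝ) ^ (5 / 4 - ρ.re) * (Real.log q + 1) *
    (2 + |ρ.im|) * ((⌊V⌋₊ : ℝ) * ⌊W⌋₊) * X ^ (-(1 / 4 : ℝ)) with hK
  have hK0 : 0 ≤ K := by rw [hK]; positivity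
  refine Literature.Analysis.Complex.VLI.integrable_of_continuous_of_norm_le hcont (R := 0)
    (C := K * 1024) fun y _ => ?_
  calc ‖detIntegrand χ U V W X ρ ((-1 / 4 : ℝ) + y * I)‖
      ≤ K * ((1 + |y|) ^ (5 / 2 : ℝ) * Real.exp (-(π * |y|) / 2)) :=
        norm_detIntegrand_left_le χ hχ hq hU hUV hW hX hρ hρ1 y
    _ ≤ K * (1024 * (1 + y ^ 2)⁻¹) := mul_le_mul_of_nonneg_left (rpow_mul_exp_le_inv_one_add_sq y) hK0
    _ = K * 1024 * (1 + y ^ 2)⁻¹ := by ring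

/-- Uniform bound for `Γ` on the strip `-1/4 ≤ re w ≤ 1` away from the real axis (`|T| ≥ 1`):
`‖Γ(x + iT)‖ ≤ 16π²(1+|T|)^{3/2}e^{-π|T|/2}/|T|`. [folklore] -/
theorem norm_Gamma_strip_le {x T : ℝ} (hx0 : -1 / 4 ≤ x) (hx1 : x ≤ 1) (hT : 1 ≤ |T|) :
    ‖Complex.Gamma (x + T * I)‖ ≤
      16 * π ^ 2 * (1 + |T|) ^ (3 / 2 : ℝ) * Real.exp (-(π * |T|) / 2) / |T| := by
  have hT0 : 0 < |T| := by linarith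
  have hnT : |T| ≤ ‖(x : ℂ) + T * I‖ := by simpa using Complex.abs_im_le_norm ((x : ℂ) + T * I)
  have hne : (x : ℂ) + T * I ≠ 0 := by
    intro h; rw [h, norm_zero] at hnT; linarith
  set B : ℝ := 16 * π ^ 2 * (1 + |T|) ^ (3 / 2 : ℝ) * Real.exp (-(π * |T|) / 2) with hB
  have hB0 : 0 ≤ B := by rw [hB]; positivity
  rcases le_or_gt 0 x with hx | hx
  · refine (norm_Gamma_le_step hx hx1 hne).trans ?_
    exact div_le_div_of_nonneg_left hB0 hT0 hnT
  · have hnT1 : |T| ≤ ‖(x : ℂ) + T * I + 1‖ := by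
      have : |T| ≤ ‖((x + 1 : ℝ) : ℂ) + T * I‖ := by
        simpa using Complex.abs_im_le_norm (((x + 1 : ℝ) : ℂ) + T * I)
      rw [show ((x + 1 : ℝ) : ℂ) + T * I = (x : ℂ) + T * I + 1 by push_cast; ring] at this
      exact this
    have hne1 : (x : ℂ) + T * I + 1 ≠ 0 := by
      intro h; rw [h, norm_zero] at hnT1; linarith
    refine (norm_Gamma_le_step₂ (by linarith) hx.le hne hne1).trans ?_
    rw [← hB]
    have hprod : |T| ≤ ‖(x : ℂ) + T * I‖ * ‖(x : ℂ) + T * I + 1‖ := by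
      calc |T| = |T| * 1 := (mul_one _).symm
        _ ≤ ‖(x : ℂ) + T * I‖ * ‖(x : ℂ) + T * I + 1‖ :=
            mul_le_mul hnT (hT.trans hnT1) zero_le_one (norm_nonneg _)
    exact div_le_div_of_nonneg_left hB0 hT0 hprod

/-- Uniform smallness of the integrand on the horizontal segments `[-1/4, 1] + iT`. [folklore] -/
theorem decay_detIntegrand (hχ : χ ≠ 1) (hU : 1 ≤ U) (hUV : U < V) (hW : 1 < W) (hX : 1 ≤ X)
    {ρ : ℂ} (hρ : 1 / 2 ≤ ρ.re) :
    ∀ ε : ℝ, 0 < ε → ∃ T₀ : ℝ, ∀ T : ℝ, T₀ ≤ |T| → ∀ x ∈ Set.Icc (-1 / 4 : ℝ) 1,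
      ‖detIntegrand χ U V W X ρ (x + T * I)‖ ≤ ε := by
  have hX0 : 0 < X := by linarith
  set C : ℝ := 5 * q * (‖ρ‖ + 1) * ((⌊V⌋₊ : ℝ) * ⌊W⌋₊) * X * (16 * π ^ 2) * 1024 with hC
  have h := Literature.Analysis.Complex.VLI.decay_of_norm_le_div (F := detIntegrand χ U V W X ρ)
    (a := -1 / 4) (b := 1) (C := C) (R := 1) ?_
  · intro ε hε
    obtain ⟨T₀, hT₀⟩ := h ε hε
    exact ⟨T₀, fun T hT x hx => hT₀ x hx T hT⟩
  intro x hx T hT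
  have hT0 : 0 < |T| := by linarith
  unfold detIntegrand
  have hre : (ρ + (x + T * I)).re = ρ.re + x := by simp
  have h1 : ‖χ.LFunction (ρ + (x + T * I))‖ ≤ 5 * q * ((‖ρ‖ + 1) * (1 + |T|)) := by
    refine (norm_LFunction_le_crude' χ hχ (s := ρ + (x + T * I)) (by rw [hre]; linarith [hx.1])).trans ?_
    refine mul_le_mul_of_nonneg_left ?_ (by positivity)
    calc ‖ρ + (x + T * I)‖ ≤ ‖ρ‖ + ‖(x : ℂ) + T * I‖ := norm_add_le _ _
      _ ≤ ‖ρ‖ + (|x| + |T|) := by gcongr; exact Complex.norm_le_abs_re_add_abs_im _ |>.trans (by simp)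
      _ ≤ (‖ρ‖ + 1) * (1 + |T|) := by
          have hx1 : |x| ≤ 1 := abs_le.2 ⟨by linarith [hx.1], hx.2⟩
          nlinarith [norm_nonneg ρ, abs_nonneg T]
  have h2 : ‖Fpoly χ U V W (ρ + (x + T * I))‖ ≤ (⌊V⌋₊ : ℝ) * ⌊W⌋₊ :=
    norm_Fpoly_le χ hU hUV hW (by rw [hre]; linarith [hx.1])
  have h3 : ‖(X : ℂ) ^ ((x : ℂ) + T * I)‖ ≤ X := by
    rw [Complex.norm_cpow_eq_rpow_re_of_pos hX0]
    simp only [Complex.add_re, Complex.ofReal_re, Complex.mul_re, Complex.I_re, mul_zero,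
      Complex.ofReal_im, Complex.I_im, mul_one, sub_self, add_zero]
    calc X ^ x ≤ X ^ (1 : ℝ) := Real.rpow_le_rpow_of_exponent_le hX hx.2
      _ = X := Real.rpow_one X
  have h4 := norm_Gamma_strip_le hx.1 hx.2 hT
  have h5 : (1 + |T|) * ((1 + |T|) ^ (3 / 2 : ℝ) * Real.exp (-(π * |T|) / 2)) ≤ 1024 := by
    have e : (1 + |T|) * ((1 + |T|) ^ (3 / 2 : ℝ) * Real.exp (-(π * |T|) / 2)) =
        (1 + |T|) ^ (5 / 2 : ℝ) * Real.exp (-(π * |T|) / 2) := by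
      rw [← mul_assoc, ← Real.rpow_one_add' (by positivity) (by norm_num)]; norm_num
    rw [e]
    refine (rpow_mul_exp_le_inv_one_add_sq T).trans ?_
    have : (1 + T ^ 2)⁻¹ ≤ 1 := inv_le_one_of_one_le₀ (by nlinarith)
    linarith
  rw [norm_mul, norm_mul, norm_mul]
  calc ‖χ.LFunction (ρ + (x + T * I))‖ * ‖Fpoly χ U V W (ρ + (x + T * I))‖ *
        ‖(X : ℂ) ^ ((x : ℂ) + T * I)‖ * ‖Complex.Gamma (x + T * I)‖
      ≤ (5 * q * ((‖ρ‖ + 1) * (1 + |T|))) * ((⌊V⌋₊ : ℝ) * ⌊W⌋₊) * X *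
        (16 * π ^ 2 * (1 + |T|) ^ (3 / 2 : ℝ) * Real.exp (-(π * |T|) / 2) / |T|) := by
        gcongr
    _ = 5 * q * (‖ρ‖ + 1) * ((⌊V⌋₊ : ℝ) * ⌊W⌋₊) * X * (16 * π ^ 2) *
        ((1 + |T|) * ((1 + |T|) ^ (3 / 2 : ℝ) * Real.exp (-(π * |T|) / 2))) / |T| := by
        field_simp
    _ ≤ 5 * q * (‖ρ‖ + 1) * ((⌊V⌋₊ : ℝ) * ⌊W⌋₊) * X * (16 * π ^ 2) * 1024 / |T| := by
        have hX' : (0 : ℝ) ≤ X := hX0.le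
        gcongr
    _ = C / |T| := by rw [hC]

/-! ### The contour identity and the detection bound -/

/-- **Heath-Brown's (11.8)**: for `χ ≠ 1`, `X ≥ 1` and `re ρ > 0`,
`Σ_n c(n) χ(n) n^{-ρ} e^{-n/X} = (1/2π) ∫ G(1 + iy) dy`. [cite: HeathBrown1992PLMS, §11 (11.8)] -/
theorem tsum_bcoef_exp_eq_integral (hU : 1 ≤ U) (hUV : U < V) (hW : 1 < W) (hX : 1 ≤ X) {ρ : ℂ}
    (hρ : 0 < ρ.re) :
    ∑' n : ℕ, (if n = 0 then 0 else bcoef χ U V W ρ n * (Real.exp (-(n * X⁻¹)) : ℂ)) =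
      (1 / (2 * π) : ℂ) * ∫ y : ℝ, detIntegrand χ U V W X ρ (1 + y * I) := by
  have hX0 : 0 < X := by linarith
  have hsum : LSeriesSummable (bcoef χ U V W ρ) ((1 : ℝ) : ℂ) :=
    LSeriesSummable_bcoef χ hU hUV hW ρ (c := 1) (by linarith)
  have h := Literature.Analysis.Complex.tsum_mul_exp_neg_eq_integral_LSeries (bcoef χ U V W ρ)
    one_pos (by norm_num) hsum (inv_pos.2 hX0)
  simp only [Complex.ofReal_one] at h
  rw [h]
  congr 1
  refine integral_congr_ae (Filter.Eventually.of_forall fun y => ?_)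
  have hre : 1 < (ρ + (1 + y * I)).re := by simp; linarith
  simp only
  have inv_cpow_neg_eq : ∀ w : ℂ, ((X⁻¹ : ℝ) : ℂ) ^ (-w) = (X : ℂ) ^ w := fun w => by
    rw [Complex.ofReal_inv, Complex.inv_cpow _ _ (by
      rw [Complex.arg_ofReal_of_nonneg hX0.le]; exact Real.pi_ne_zero.symm), Complex.cpow_neg, inv_inv]
  rw [LSeries_bcoef, LSeries_coefChi_eq χ hU hUV hW hre, inv_cpow_neg_eq, detIntegrand]
  ring

/-- **The shift to `re w = -1/4`**: for a zero `ρ` of `L(s, χ)` (`χ ≠ 1`, `q ≥ 8`, `3/4 ≤ re ρ ≤ 1`,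
`X ≥ 1`) the integrals along `re w = 1` and `re w = -1/4` agree (the only singularity, at
`w = 0`, is removable since `L(ρ, χ) = 0`). [cite: HeathBrown1992PLMS, §11 (11.9)] -/
theorem integral_detIntegrand_shift (hχ : χ ≠ 1) (hq : 8 ≤ q) (hU : 1 ≤ U) (hUV : U < V) (hW : 1 < W)
    (hX : 1 ≤ X) {ρ : ℂ} (hρ0 : χ.LFunction ρ = 0) (hρ : 3 / 4 ≤ ρ.re) (hρ1 : ρ.re ≤ 1) :
    ∫ y : ℝ, detIntegrand χ U V W X ρ (1 + y * I) =
      ∫ y : ℝ, detIntegrand χ U V W X ρ ((-1 / 4 : ℝ) + y * I) := by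
  have hX0 : 0 < X := by linarith
  have h := Literature.Analysis.Complex.integral_vertical_sub_eq_sum_of_simplePoles
    (F := detIntegrand χ U V W X ρ) (a := -1 / 4) (b := 1) (by norm_num) ({0} : Finset ℂ)
    (fun _ => 0) {w : ℂ | -1 < w.re} (isOpen_lt continuous_const Complex.continuous_re)
    (fun w hw => by
      simp only [Set.mem_preimage, Set.mem_Icc] at hw
      show -1 < w.re; linarith [hw.1])
    (fun p hp => by
      rw [Finset.mem_singleton] at hp; subst hp
      simp only [Complex.zero_re, Set.mem_Ioo]; norm_num)
    (by rw [Finset.coe_singleton]; exact differentiableOn_detIntegrand χ hχ U V W hX0 ρ)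
    (fun p hp => by
      rw [Finset.mem_singleton] at hp; subst hp
      refine ⟨detNumer χ U V W X ρ, {w : ℂ | -1 < w.re},
        (isOpen_lt continuous_const Complex.continuous_re).mem_nhds (by simp), 
        differentiableOn_detNumer χ hχ U V W hX0 ρ, ?_, fun z _ hz => detIntegrand_eq_div χ U V W X ρ hz⟩
      simp [detNumer, hρ0])
    (integrable_detIntegrand_left χ hχ hq hU hUV hW hX0 hρ hρ1)
    (by simpa using integrable_detIntegrand_right χ hχ hU hUV hW hX (by linarith))
    (decay_detIntegrand χ hχ hU hUV hW hX (by linarith))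
  simp only [Finset.sum_singleton, mul_zero, Complex.ofReal_one] at h
  exact (sub_eq_zero.1 h)

/-- **Zero detection** (Heath-Brown's (11.9) with `φ = 1`): for `χ ≠ 1` mod `q ≥ 8`, Graham
weights with `1 ≤ U < V`, `W > 1`, `X ≥ 1`, and a zero `ρ = β + iγ` of `L(s, χ)` with
`3/4 ≤ β ≤ 1`,
`|Σ_n c(n) χ(n) n^{-ρ} e^{-n/X}| ≤ 512 K`,
`K = (256π²e/3) q^{5/4 − β} (log q + 1) (2 + |γ|) ⌊V⌋⌊W⌋ X^{-1/4}`.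
[cite: HeathBrown1992PLMS, §11 (11.9)] -/
theorem norm_tsum_bcoef_exp_le (hχ : χ ≠ 1) (hq : 8 ≤ q) (hU : 1 ≤ U) (hUV : U < V) (hW : 1 < W)
    (hX : 1 ≤ X) {ρ : ℂ} (hρ0 : χ.LFunction ρ = 0) (hρ : 3 / 4 ≤ ρ.re) (hρ1 : ρ.re ≤ 1) :
    ‖∑' n : ℕ, (if n = 0 then 0 else bcoef χ U V W ρ n * (Real.exp (-(n * X⁻¹)) : ℂ))‖ ≤
      512 * (256 * π ^ 2 * Real.exp 1 / 3 * (q : ℝ) ^ (5 / 4 - ρ.re) * (Real.log q + 1) *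
        (2 + |ρ.im|) * ((⌊V⌋₊ : ℝ) * ⌊W⌋₊) * X ^ (-(1 / 4 : ℝ))) := by
  have hX0 : 0 < X := by linarith
  set K : ℝ := 256 * π ^ 2 * Real.exp 1 / 3 * (q : ℝ) ^ (5 / 4 - ρ.re) * (Real.log q + 1) *
    (2 + |ρ.im|) * ((⌊V⌋₊ : ℝ) * ⌊W⌋₊) * X ^ (-(1 / 4 : ℝ)) with hK
  have hK0 : 0 ≤ K := by rw [hK]; positivity
  rw [tsum_bcoef_exp_eq_integral χ hU hUV hW hX (by linarith),
    integral_detIntegrand_shift χ hχ hq hU hUV hW hX hρ0 hρ hρ1, norm_mul]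
  have hbound : ∀ y : ℝ, ‖detIntegrand χ U V W X ρ ((-1 / 4 : ℝ) + y * I)‖ ≤
      K * 1024 * (1 + y ^ 2)⁻¹ := by
    intro y
    calc ‖detIntegrand χ U V W X ρ ((-1 / 4 : ℝ) + y * I)‖
        ≤ K * ((1 + |y|) ^ (5 / 2 : ℝ) * Real.exp (-(π * |y|) / 2)) :=
          norm_detIntegrand_left_le χ hχ hq hU hUV hW hX0 hρ hρ1 y
      _ ≤ K * (1024 * (1 + y ^ 2)⁻¹) := mul_le_mul_of_nonneg_left (rpow_mul_exp_le_inv_one_add_sq y) hK0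
      _ = K * 1024 * (1 + y ^ 2)⁻¹ := by ring
  have hint : ‖∫ y : ℝ, detIntegrand χ U V W X ρ ((-1 / 4 : ℝ) + y * I)‖ ≤ K * 1024 * π := by
    calc ‖∫ y : ℝ, detIntegrand χ U V W X ρ ((-1 / 4 : ℝ) + y * I)‖
        ≤ ∫ y : ℝ, K * 1024 * (1 + y ^ 2)⁻¹ :=
          norm_integral_le_of_norm_le ((integrable_inv_one_add_sq).const_mul _)
            (Filter.Eventually.of_forall hbound)
      _ = K * 1024 * π := by rw [MeasureTheory.integral_const_mul, integral_univ_inv_one_add_sq]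
  have hc : ‖(1 / (2 * π) : ℂ)‖ = 1 / (2 * π) := by
    rw [show (1 / (2 * π) : ℂ) = ((1 / (2 * π) : ℝ) : ℂ) by push_cast; ring, Complex.norm_real,
      Real.norm_of_nonneg (by positivity)]
  rw [hc]
  calc 1 / (2 * π) * ‖∫ y : ℝ, detIntegrand χ U V W X ρ ((-1 / 4 : ℝ) + y * I)‖
      ≤ 1 / (2 * π) * (K * 1024 * π) := mul_le_mul_of_nonneg_left hint (by positivity)
    _ = 512 * K := by field_simp; ring

end Literature.NumberTheory.LFunctions.LFDSingle
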